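import Summits.QuantumFields.YangMills.Theorems.BalabanUVNodesC44IterMhAtRecord
import Literature.MathematicalPhysics.QuantumFieldTheory.Balaban1983to89.Node00.BgAveragingPrOfRecord
import HarnessLib

/-!
# (ℓa-C) ROAD B, FRAMED EDITION (ρ-frame-min), FILE F2′ᵖʳ∕F4′-0ᵖʳ — THE CAUCHY LINE ESTIMATE FOR THE FRAMED («double-bar») CHART `G^{pr}X = (1/i)log(Ū^{pr}(e^{iX}U₀)·Ū^k(U₀)⋆)`
# over node00-def-Y's frame DATUM `𝔥` (✓`Node00.BgAveragingPrOfRecord`): line derivative `= L^k·Q^{pr}_k(U₀)X` on traceless `X`, and [B11] (44) from a linear bound on a polydisc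

Cell `pub-ymgap` ∕ `ym-nodeO-ideate`, porter lineage `ymgap-nodeO-port-PTB-1` (gen 9); re-press (B) of director-ym g23 №608 (ROAD WORD FINAL: edition (ρ-frame-min) keyed on C's chart),
filed behind the ACCEPT of node00-def-Y's (A2); `--kind proof --supports stmt-QuantumFields-27238 --as helper`; count-neutral; NEW basename, append-nothing (the frame-free F1∕F2′∕F4′-0
files ✓`…C44IterMhLinearisation` ∕ ✓`…CauchyLine` stay as they are, USE-HELD for the frame-free chart).  [B7] = [Balaban1985Averaging]; [B11] = [Balaban1985Variational];
[BIII] = [Balaban1985BackgroundPropagators]; [I] = [Balaban1987RG1].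

THE OBJECTS (node00-def-Y (A2) ✓`Node00.BgAveragingPrOfRecord`, consumed BY NAME): a frame DATUM `𝔥 : FrameDatum P N k U₀` — window `𝔥.dom ∈ 𝓝 ↑U₀`, analytic frame `h = 𝔥.map` and
`h⁻¹ = 𝔥.inv` with `h·h⁻¹ = 1` on the window, `h(↑U₀) = 1`, `Dh(↑U₀) = 𝔥.deriv`; the FRAMED average `Ū^{pr}(V)(c) = h(V)(c₋)·Ū^k_h(V)(c)·h⁻¹(V)(c₊)` (`avPrM`; [B7] (89)∕(92) p.31
placement); its linearisation `Q^{pr}_k(U₀) = Q_k(U₀) − frameCorr ∘ Dh ∘ leftVelC` (`qPrCplxOp`; [BIII] (3.113)–(3.115) p.418); the framed line derivative `hasDerivAt_logChart_avPrM_line`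
and the analyticity `analyticAt_avPrM_apply`.

WHAT IS PROVED (0 def, 0 sorry, axioms standard; ns `Summit.QuantumFields.YangMills.Theorems.C44IterMh`; every row GENERIC in the datum `𝔥`, under the (0.4) guard of `U₀` below `k`
where stated):
* `leftVelC_eq`; `framedLogChart_zero` (`G^{pr}(0) = 0`); `hasDerivAt_framedLogChart_line` — def-Y's line derivative in `1∕i`-free normal form (CONSUMED by name, a 6-line
  conversion, not re-proved); ★★ `framedLineDeriv_eq_qPrCplxOp` ∕ `deriv_framedLogChart_line_eq`: on TRACELESS `Y`, `d∕dt|₀ G^{pr}(tY) = L^k·Q^{pr}_k(U₀)Y`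
  (F1 ✓`fderiv_iterMh_mul_star_eq_qCplxOp` for the un-framed velocity + def-Y's `frameCorr_apply` for the two frame velocities);
* `differentiableOn_framedLogChart_line`; ★★ `norm_framedLogChart_sub_qPrCplxOp_le_of_line` (Cauchy on the disc `|t| < R`, `R ≥ 4`, with `sup ‖G^{pr}(tX)‖ ≤ B`:
  `‖G^{pr}X − L^k·Q^{pr}X‖ ≤ 8B∕R²`; lit ✓`norm_sub_sub_le_of_forall_mem_ball`); ★★★ `norm_framedLogChart_sub_qPrCplxOp_le_of_linearBound` — (44) for the FRAMED remainder:
  `‖G^{pr}X − L^k·Q^{pr}X‖ ≤ (8C₀∕ρ₀)·(L^k‖X‖)²` for traceless `X` with `4L^k‖X‖ ≤ ρ₀`, from ℂ-differentiability and `‖G^{pr}Y‖ ≤ C₀·L^k‖Y‖` on the traceless polydisc `L^k‖Y‖ < ρ₀`;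
* the near-identity algebra of the framed package: `prod3_sub_one_le_two_mul`, `norm_mul3_sub_one_le`, `norm_logOver_le_two_mul'` (generic-`V` [B7] (26)),
  ★ `norm_avPrM_mul_star_sub_one_le` (`‖Ū^{pr}(V)Ū₀⋆ − 1‖ ≤ (1+θ)(1+δ)(1+θ) − 1` from `‖h − 1‖, ‖h⁻¹ − 1‖ ≤ θ` and `‖Ū_h(V)Ū₀⋆ − 1‖ ≤ δ`; unitary conjugation is an isometry),
  `analyticAt_framedLogChart` (the framed chart is analytic on the window ∩ the polydisc letter ∩ the framed log-disc).

HONEST FRAMING.  Chart calculus over a frame DATUM, nothing more: NO frame is constructed here (the hierarchical frame (A1) `hierFrameDatumOfRecord` of [B7] (78)–(87) is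
node00-def-Y's and NOT yet in the tree), NO bound on `h` is proved (frame bounds enter the record file F5ᵖʳ `…C44IterMhFramedAtRecord` as DISPLAYED hypotheses), nothing of
[B7] Prop. 5 ∕ [B11] Prop. 4 ∕ [BIII] Thm 3.12 is proved; at the datum `FrameDatum.frameless k U₀` every row here IS the frame-free row (def-Y's `_frameless` identities — the
VACUITY GUARD of №608 (4) is theirs and is consumed, not restated).  (R1)∕(R2) OPEN; K0ᴬ ⟨stmt-QuantumFields-27238⟩ NOT closed; NODE O 0∕1; COUNT 8∕28 · K 1∕4 UNMOVED;
finite `𝕋⁴_{L^K}` at fixed ε — NOT continuum ∕ ℝ⁴ ∕ OS ∕ Clay; **the Yang–Mills mass gap (Clay) is NOT proved by any of this.**  No `sorry`, `instance`, `notation`, `set_option`;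
standard axioms.
-/

noncomputable section

open scoped Matrix Matrix.Norms.L2Operator InnerProductSpace ComplexConjugate Topology

namespace Summit.QuantumFields.YangMills.Theorems.C44IterMh

open Literature.MathematicalPhysics.QuantumFieldTheory.Balaban1983to89
open Literature.MathematicalPhysics.QuantumFieldTheory.Balaban1983to89.Node00
open BlockAveraging
open B15AveragingHolomorphic (iterMh loopMh differentiableAt_iterMh coeField_iter_eq_iterMh)
open ExpMeanLog (expMeanLogSU)
open T4Continuum BlockAveraging
open B11Eq115Space (NegSup NegSize levWeight levWeight_apply)
open NormedSpace (exp)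
open Filter Metric Set
open Literature.Analysis.Complex (norm_sub_sub_le_of_forall_mem_ball)
open MatrixLog (mlog)

section Framed

variable {P : Params} {N : ℕ} [NeZero N] {k : ℕ} {U₀ : GaugeField P 0 (SU N)}

omit [NeZero N] in
/-- The left-velocity field `b ↦ Y(b)·U₀(b)` IS def-Y's `leftVelC U₀ Y`. [cite: Balaban1985Variational, (19) p.281 (bookkeeping)] -/
theorem leftVelC_eq (Y : PBond P 0 → Matrix (Fin N) (Fin N) ℂ) :
    (fun b => Y b * (U₀ b : Matrix (Fin N) (Fin N) ℂ)) = leftVelC U₀ Y := by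
  funext b; rw [leftVelC_apply]

/-- `G^{pr}(0) = 0`: at `X = 0` the chart sits at `↑U₀`, the frame is trivial there (`avPrM_bg`), and `log 1 = 0` (F2′ ✓`logChart_iterMh_zero`).
[cite: Balaban1985Variational, (44) p.285; Balaban1985Averaging, (92) p.31] -/
theorem framedLogChart_zero (𝔥 : FrameDatum P N k U₀) (h : SmallBelow (fun j => blockAvg (P := P) (j := j) expMeanLogSU) k U₀) :
    logOver (coeField (Averaging.iter (fun j => blockAvg (P := P) (j := j) expMeanLogSU) k U₀)) (avPrM 𝔥 (expOver U₀ 0)) = 0 := by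
  rw [expOver_zero, avPrM_bg, ← expOver_zero (U₀ := U₀)]
  exact logChart_iterMh_zero U₀ h

/-- ★★ **THE LINE DERIVATIVE OF THE FRAMED LOG-AVERAGED CHART, `1∕i`-FREE NORMAL FORM** — def-Y's `hasDerivAt_logChart_avPrM_line` (A2 §1b) CONSUMED BY NAME, with the
`(1∕i)·(… i·Y …)` pairs cancelled by linearity of `D(Ū^k_h)(↑U₀)` and `Dh(↑U₀)`: under the guard below `k`, for every direction `Y` and coarse bond `c`,
`d∕dt|₀ (1/i)·log( Ū^{pr}(e^{itY}U₀)(c)·Ū^k(U₀)(c)⋆ ) = D(Ū^k_h)(↑U₀)[Y·U₀](c)·Ū^k(U₀)(c)⋆ + Dh[Y·U₀](c₋) − Ū^k(U₀)(c)·Dh[Y·U₀](c₊)·Ū^k(U₀)(c)⋆`.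
[cite: Balaban1985Averaging, (92) p.31; Balaban1985BackgroundPropagators, (3.114)–(3.115) p.418; Balaban1985Variational, (44) p.285] -/
theorem hasDerivAt_framedLogChart_line (𝔥 : FrameDatum P N k U₀) (h : SmallBelow (fun j => blockAvg (P := P) (j := j) expMeanLogSU) k U₀)
    (Y : PBond P 0 → Matrix (Fin N) (Fin N) ℂ) (c : PBond P k) :
    HasDerivAt (fun t : ℂ => logOver (coeField (Averaging.iter (fun j => blockAvg (P := P) (j := j) expMeanLogSU) k U₀)) (avPrM 𝔥 (expOver U₀ (t • Y))) c)
      (fderiv ℂ (iterMh k : (PBond P 0 → Matrix (Fin N) (Fin N) ℂ) → PBond P k → Matrix (Fin N) (Fin N) ℂ) (coeField U₀)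
            (fun b => Y b * (U₀ b : Matrix (Fin N) (Fin N) ℂ)) c *
          star ((Averaging.iter (fun j => blockAvg (P := P) (j := j) expMeanLogSU) k U₀ c : SU N) : Matrix (Fin N) (Fin N) ℂ)
        + 𝔥.deriv (fun b => Y b * (U₀ b : Matrix (Fin N) (Fin N) ℂ)) c.src
        - ((Averaging.iter (fun j => blockAvg (P := P) (j := j) expMeanLogSU) k U₀ c : SU N) : Matrix (Fin N) (Fin N) ℂ) *
            𝔥.deriv (fun b => Y b * (U₀ b : Matrix (Fin N) (Fin N) ℂ)) c.tgt *
            star ((Averaging.iter (fun j => blockAvg (P := P) (j := j) expMeanLogSU) k U₀ c : SU N) : Matrix (Fin N) (Fin N) ℂ)) 0 := by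
  refine (hasDerivAt_logChart_avPrM_line U₀ 𝔥 h Y c).congr_deriv ?_
  have hlin : (fun b => (Complex.I • Y b) * (U₀ b : Matrix (Fin N) (Fin N) ℂ)) = Complex.I • fun b => Y b * (U₀ b : Matrix (Fin N) (Fin N) ℂ) := by
    funext b; rw [Pi.smul_apply, smul_mul_assoc]
  rw [hlin]
  simp only [map_smul, Pi.smul_apply, smul_mul_assoc, mul_smul_comm, ← smul_sub, smul_smul, inv_mul_cancel₀ Complex.I_ne_zero, one_smul]
  abel

/-- ★★ **ON TRACELESS DIRECTIONS THE FRAMED LINE DERIVATIVE IS `L^k·Q^{pr}_k(U₀)Y`**: F1 ✓`fderiv_iterMh_mul_star_eq_qCplxOp` for the un-framed part, and def-Y's `frameCorr`∕`qPrCplxOp`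
unfoldings for the two frame velocities (`Ū₀ = iterM k ↑U₀ = ↑Ū^k(U₀)` under the guard, ✓`coeField_iter_eq_iterM`).
[cite: Balaban1985BackgroundPropagators, (3.13) p.393, (3.113)–(3.115) p.418; Balaban1985Variational, (44) p.285] -/
theorem framedLineDeriv_eq_qPrCplxOp (𝔥 : FrameDatum P N k U₀) (h : SmallBelow (fun j => blockAvg (P := P) (j := j) expMeanLogSU) k U₀)
    {Y : PBond P 0 → Matrix (Fin N) (Fin N) ℂ} (hY : ∀ b, (Y b).trace = 0) (c : PBond P k) :
    fderiv ℂ (iterMh k : (PBond P 0 → Matrix (Fin N) (Fin N) ℂ) → PBond P k → Matrix (Fin N) (Fin N) ℂ) (coeField U₀)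
            (fun b => Y b * (U₀ b : Matrix (Fin N) (Fin N) ℂ)) c *
          star ((Averaging.iter (fun j => blockAvg (P := P) (j := j) expMeanLogSU) k U₀ c : SU N) : Matrix (Fin N) (Fin N) ℂ)
        + 𝔥.deriv (fun b => Y b * (U₀ b : Matrix (Fin N) (Fin N) ℂ)) c.src
        - ((Averaging.iter (fun j => blockAvg (P := P) (j := j) expMeanLogSU) k U₀ c : SU N) : Matrix (Fin N) (Fin N) ℂ) *
            𝔥.deriv (fun b => Y b * (U₀ b : Matrix (Fin N) (Fin N) ℂ)) c.tgt *
            star ((Averaging.iter (fun j => blockAvg (P := P) (j := j) expMeanLogSU) k U₀ c : SU N) : Matrix (Fin N) (Fin N) ℂ)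
      = (((P.L : ℂ) ^ k) • qPrCplxOp k U₀ 𝔥 Y) c := by
  have hL : ((P.L : ℂ) ^ k) ≠ 0 := pow_ne_zero _ (Nat.cast_ne_zero.2 P.L_pos.ne')
  have hW : iterM k (coeField U₀) c = ((Averaging.iter (fun j => blockAvg (P := P) (j := j) expMeanLogSU) k U₀ c : SU N) : Matrix (Fin N) (Fin N) ℂ) := by
    rw [← coeField_iter_eq_iterM k h]; rfl
  rw [fderiv_iterMh_mul_star_eq_qCplxOp U₀ h hY c, Pi.smul_apply, qPrCplxOp_apply, Pi.sub_apply, frameCorr_apply, ← leftVelC_eq Y, hW,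
    smul_sub, smul_smul, mul_inv_cancel₀ hL, one_smul]
  abel

/-- ★ **`deriv` form**: under the guard, `d∕dt|₀ G^{pr}(tY) = L^k·Q^{pr}_k(U₀)Y` on TRACELESS `Y` (as a field on the coarse bonds).
[cite: Balaban1985BackgroundPropagators, (3.13) p.393, (3.115) p.418; Balaban1985Variational, (44) p.285] -/
theorem deriv_framedLogChart_line_eq (𝔥 : FrameDatum P N k U₀) (h : SmallBelow (fun j => blockAvg (P := P) (j := j) expMeanLogSU) k U₀)
    {Y : PBond P 0 → Matrix (Fin N) (Fin N) ℂ} (hY : ∀ b, (Y b).trace = 0) :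
    deriv (fun t : ℂ => logOver (coeField (Averaging.iter (fun j => blockAvg (P := P) (j := j) expMeanLogSU) k U₀)) (avPrM 𝔥 (expOver U₀ (t • Y)))) 0
      = ((P.L : ℂ) ^ k) • qPrCplxOp k U₀ 𝔥 Y := by
  have hall := hasDerivAt_pi.2 fun c => hasDerivAt_framedLogChart_line 𝔥 h Y c
  rw [hall.deriv]
  funext c
  exact framedLineDeriv_eq_qPrCplxOp 𝔥 h hY c

/-- Along a line `t ↦ tX` through points where the FRAMED chart is ℂ-differentiable, `t ↦ G^{pr}(tX)` is ℂ-differentiable on the disc `|t| < R`.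
[cite: Balaban1985Variational, (51)–(53) p.286; Balaban1987RG1, (0.8) p.253] -/
theorem differentiableOn_framedLogChart_line (𝔥 : FrameDatum P N k U₀) {R : ℝ} (X : PBond P 0 → Matrix (Fin N) (Fin N) ℂ)
    (hdiff : ∀ t : ℂ, ‖t‖ < R → DifferentiableAt ℂ (fun Y : PBond P 0 → Matrix (Fin N) (Fin N) ℂ =>
      logOver (coeField (Averaging.iter (fun j => blockAvg (P := P) (j := j) expMeanLogSU) k U₀)) (avPrM 𝔥 (expOver U₀ Y))) (t • X)) :
    DifferentiableOn ℂ (fun t : ℂ =>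
      logOver (coeField (Averaging.iter (fun j => blockAvg (P := P) (j := j) expMeanLogSU) k U₀)) (avPrM 𝔥 (expOver U₀ (t • X)))) (ball 0 R) := by
  intro t ht
  rw [mem_ball_zero_iff] at ht
  have hline : DifferentiableAt ℂ (fun s : ℂ => s • X) t := differentiableAt_id.smul_const X
  exact ((hdiff t ht).comp t hline).differentiableWithinAt

/-- ★★★ **THE FRAMED (44) REMAINDER FROM ONE TRACELESS COMPLEX LINE**: if `G^{pr} Y := (1/i)·log(Ū^{pr}(e^{iY}U₀)·Ū^k(U₀)⋆)` is ℂ-differentiable at every `tX`, `|t| < R` (`4 ≤ R`),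
with `‖G^{pr}(tX)‖ ≤ B` there, and `tr X_b = 0`, then `‖G^{pr} X − L^k • Q^{pr}_k(U₀)X‖ ≤ 8B∕R²` (Cauchy's inequality for the second Taylor remainder, lit ✓`CauchyTaylorBall`;
`G^{pr} 0 = 0`, derivative `L^k • Q^{pr}X` at `0`).  F4′-0's lemma re-run on the framed chart.
[cite: Balaban1985Variational, (44) p.285, (52)–(53) p.286; Balaban1987RG1, (0.8) p.253, p.254; Balaban1985Averaging, (92) p.31] -/
theorem norm_framedLogChart_sub_qPrCplxOp_le_of_line (𝔥 : FrameDatum P N k U₀) (h : SmallBelow (fun j => blockAvg (P := P) (j := j) expMeanLogSU) k U₀)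
    {R B : ℝ} (hR : 4 ≤ R) {X : PBond P 0 → Matrix (Fin N) (Fin N) ℂ} (hX : ∀ b, (X b).trace = 0)
    (hdiff : ∀ t : ℂ, ‖t‖ < R → DifferentiableAt ℂ (fun Y : PBond P 0 → Matrix (Fin N) (Fin N) ℂ =>
      logOver (coeField (Averaging.iter (fun j => blockAvg (P := P) (j := j) expMeanLogSU) k U₀)) (avPrM 𝔥 (expOver U₀ Y))) (t • X))
    (hB : ∀ t : ℂ, ‖t‖ < R →
      ‖logOver (coeField (Averaging.iter (fun j => blockAvg (P := P) (j := j) expMeanLogSU) k U₀)) (avPrM 𝔥 (expOver U₀ (t • X)))‖ ≤ B) :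
    ‖logOver (coeField (Averaging.iter (fun j => blockAvg (P := P) (j := j) expMeanLogSU) k U₀)) (avPrM 𝔥 (expOver U₀ X)) - ((P.L : ℂ) ^ k) • qPrCplxOp k U₀ 𝔥 X‖
      ≤ 8 * B / R ^ 2 := by
  have hRpos : 0 < R := by linarith
  set f := fun t : ℂ =>
    logOver (coeField (Averaging.iter (fun j => blockAvg (P := P) (j := j) expMeanLogSU) k U₀)) (avPrM 𝔥 (expOver U₀ (t • X))) with hf
  have hfd : DifferentiableOn ℂ f (ball 0 R) := differentiableOn_framedLogChart_line 𝔥 X hdiff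
  have hfB : ∀ z ∈ ball (0 : ℂ) R, ‖f z‖ ≤ B := fun z hz => hB z (mem_ball_zero_iff.1 hz)
  have hz : ‖(1 : ℂ) - 0‖ ≤ R / 4 := by rw [sub_zero, norm_one]; linarith
  have hc := norm_sub_sub_le_of_forall_mem_ball (f := f) (c := 0) hRpos hfd hfB hz
  have h0 : f 0 = 0 := by
    show logOver _ (avPrM 𝔥 (expOver U₀ ((0 : ℂ) • X))) = 0
    rw [zero_smul]; exact framedLogChart_zero 𝔥 h
  have hderiv : deriv f 0 = ((P.L : ℂ) ^ k) • qPrCplxOp k U₀ 𝔥 X := deriv_framedLogChart_line_eq 𝔥 h hX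
  have h1 : f 1 = logOver (coeField (Averaging.iter (fun j => blockAvg (P := P) (j := j) expMeanLogSU) k U₀)) (avPrM 𝔥 (expOver U₀ X)) := by
    show logOver _ (avPrM 𝔥 (expOver U₀ ((1 : ℂ) • X))) = _
    rw [one_smul]
  rw [h0, hderiv, h1] at hc
  simp only [sub_zero, norm_one, one_smul, one_pow, mul_one] at hc
  exact hc

/-- ★★★ **THE CONSUMED SHAPE — FRAMED (44) FROM A LINEAR BOUND ON THE TRACELESS SCALED POLYDISC**: if for every TRACELESS `Y` with `L^k‖Y‖ < ρ₀` the framed chart `G^{pr}` is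
ℂ-differentiable at `Y` and `‖G^{pr} Y‖ ≤ C₀·L^k‖Y‖`, then for every traceless `X` with `4·L^k‖X‖ ≤ ρ₀`: `‖G^{pr} X − L^k • Q^{pr}_k(U₀)X‖ ≤ (8C₀∕ρ₀)·(L^k‖X‖)²` —
[B11] (44) for the FRAMED remainder with `C₂ = 8C₀∕ρ₀`, k-free exactly when `(ρ₀, C₀)` are. [cite: Balaban1985Variational, (44) p.285, Prop. 4 p.293; Balaban1987RG1, (0.8) p.253; Balaban1985Averaging, (92) p.31] -/
theorem norm_framedLogChart_sub_qPrCplxOp_le_of_linearBound (𝔥 : FrameDatum P N k U₀)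
    (h : SmallBelow (fun j => blockAvg (P := P) (j := j) expMeanLogSU) k U₀) {ρ₀ C₀ : ℝ} (hC₀ : 0 ≤ C₀)
    (hdiff : ∀ Y : PBond P 0 → Matrix (Fin N) (Fin N) ℂ, (∀ b, (Y b).trace = 0) → (P.L : ℝ) ^ k * ‖Y‖ < ρ₀ →
      DifferentiableAt ℂ (fun Y : PBond P 0 → Matrix (Fin N) (Fin N) ℂ =>
        logOver (coeField (Averaging.iter (fun j => blockAvg (P := P) (j := j) expMeanLogSU) k U₀)) (avPrM 𝔥 (expOver U₀ Y))) Y)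
    (hbound : ∀ Y : PBond P 0 → Matrix (Fin N) (Fin N) ℂ, (∀ b, (Y b).trace = 0) → (P.L : ℝ) ^ k * ‖Y‖ < ρ₀ →
      ‖logOver (coeField (Averaging.iter (fun j => blockAvg (P := P) (j := j) expMeanLogSU) k U₀)) (avPrM 𝔥 (expOver U₀ Y))‖ ≤ C₀ * ((P.L : ℝ) ^ k * ‖Y‖))
    {X : PBond P 0 → Matrix (Fin N) (Fin N) ℂ} (hX : ∀ b, (X b).trace = 0) (hXρ : 4 * ((P.L : ℝ) ^ k * ‖X‖) ≤ ρ₀) :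
    ‖logOver (coeField (Averaging.iter (fun j => blockAvg (P := P) (j := j) expMeanLogSU) k U₀)) (avPrM 𝔥 (expOver U₀ X)) - ((P.L : ℂ) ^ k) • qPrCplxOp k U₀ 𝔥 X‖
      ≤ 8 * C₀ / ρ₀ * ((P.L : ℝ) ^ k * ‖X‖) ^ 2 := by
  have hLk : 0 < (P.L : ℝ) ^ k := pow_pos (Nat.cast_pos.2 P.L_pos) k
  by_cases hX0 : X = 0
  · subst hX0
    rw [expOver_zero, avPrM_bg, ← B15AveragingHolomorphic.coeField_iter_eq_iterMh k h, logOver_coeField_self, map_zero, smul_zero, sub_zero, norm_zero]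
    have hρ₀ : 0 ≤ ρ₀ := by rw [norm_zero, mul_zero, mul_zero] at hXρ; exact hXρ
    positivity
  have hXpos : 0 < ‖X‖ := norm_pos_iff.2 hX0
  set s : ℝ := (P.L : ℝ) ^ k * ‖X‖ with hs
  have hspos : 0 < s := mul_pos hLk hXpos
  have hρ₀ : 0 < ρ₀ := lt_of_lt_of_le (by positivity) hXρ
  set R : ℝ := ρ₀ / s with hR
  have hR4 : 4 ≤ R := by rw [hR, le_div_iff₀ hspos]; exact hXρ
  have htr : ∀ t : ℂ, ∀ b, ((t • X) b).trace = 0 := fun t b => by rw [Pi.smul_apply, Matrix.trace_smul, hX b, smul_zero]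
  have hin : ∀ t : ℂ, ‖t‖ < R → (P.L : ℝ) ^ k * ‖t • X‖ < ρ₀ := by
    intro t ht
    rw [norm_smul, ← mul_assoc, mul_comm ((P.L : ℝ) ^ k) ‖t‖, mul_assoc, ← hs]
    rw [hR, lt_div_iff₀ hspos] at ht
    exact ht
  have hB : ∀ t : ℂ, ‖t‖ < R →
      ‖logOver (coeField (Averaging.iter (fun j => blockAvg (P := P) (j := j) expMeanLogSU) k U₀)) (avPrM 𝔥 (expOver U₀ (t • X)))‖ ≤ C₀ * ρ₀ := by
    intro t ht
    refine (hbound (t • X) (htr t) (hin t ht)).trans ?_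
    exact mul_le_mul_of_nonneg_left (hin t ht).le hC₀
  have hmain := norm_framedLogChart_sub_qPrCplxOp_le_of_line 𝔥 h hR4 hX (fun t ht => hdiff (t • X) (htr t) (hin t ht)) hB
  refine hmain.trans (le_of_eq ?_)
  rw [hR]
  field_simp

/-- `1 + x`-products: `(1+a)(1+b)(1+c) − 1 ≤ 2(a+b+c)` when `a, b, c ≥ 0` and `a + b + c ≤ 1`. [folklore] -/
theorem prod3_sub_one_le_two_mul {a b c : ℝ} (ha : 0 ≤ a) (hb : 0 ≤ b) (hc : 0 ≤ c) (hσ : a + b + c ≤ 1) :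
    (1 + a) * (1 + b) * (1 + c) - 1 ≤ 2 * (a + b + c) := by
  nlinarith [mul_nonneg ha hb, mul_nonneg hb hc, mul_nonneg ha hc, mul_nonneg (mul_nonneg ha hb) hc,
    mul_le_mul_of_nonneg_left hσ (add_nonneg (add_nonneg ha hb) hc), mul_le_mul_of_nonneg_left hσ (mul_nonneg (mul_nonneg ha hb) hc),
    mul_le_mul_of_nonneg_left hσ (mul_nonneg ha hb)]

omit [NeZero N] in
/-- **Three near-identity factors**: `‖ABC − 1‖ ≤ (1+a)(1+b)(1+c) − 1`. [folklore] -/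
theorem norm_mul3_sub_one_le {A B C : Matrix (Fin N) (Fin N) ℂ} {a b c : ℝ} (ha : ‖A - 1‖ ≤ a) (hb : ‖B - 1‖ ≤ b) (hc : ‖C - 1‖ ≤ c) :
    ‖A * B * C - 1‖ ≤ (1 + a) * (1 + b) * (1 + c) - 1 := by
  have h1 := norm_mul_sub_one_le_of_le₂ ha hb
  have h2 := norm_mul_sub_one_le_of_le₂ h1 hc
  have e : (1 + ((1 + a) * (1 + b) - 1)) * (1 + c) - 1 = (1 + a) * (1 + b) * (1 + c) - 1 := by ring
  rwa [e] at h2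

/-- **The log-coordinate of a field near the coarse background is small**: `‖V(c)·Ū(c)⋆ − 1‖ ≤ B ≤ ½` at every coarse bond ⇒ `‖(1/i)log(V·Ū⋆)‖ ≤ 2B`
(generic-`V` edition of F5 ✓`norm_logOver_le_two_mul`). [cite: Balaban1985Averaging, (21) p.21, (26) p.22] -/
theorem norm_logOver_le_two_mul' (U₀ : GaugeField P 0 (SU N)) (k : ℕ) {V : PBond P k → Matrix (Fin N) (Fin N) ℂ} {B : ℝ} (hB0 : 0 ≤ B) (hB : B ≤ 1 / 2)
    (h : ∀ c : PBond P k, ‖V c * star ((Averaging.iter (fun j => blockAvg (P := P) (j := j) expMeanLogSU) k U₀ c : SU N) : Matrix (Fin N) (Fin N) ℂ) - 1‖ ≤ B) :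
    ‖logOver (coeField (Averaging.iter (fun j => blockAvg (P := P) (j := j) expMeanLogSU) k U₀)) V‖ ≤ 2 * B := by
  refine (pi_norm_le_iff_of_nonneg (by positivity)).2 fun c => ?_
  rw [logOver_apply, norm_smul, norm_inv, Complex.norm_I, inv_one, one_mul, coeField_apply]
  exact (MatrixLog.norm_mlog_le_two_mul ((h c).trans hB)).trans (by linarith [h c])

/-- ★ **THE FRAMED RELATIVE AVERAGE IS NEAR `1` WHEN THE UN-FRAMED ONE IS AND THE FRAME IS NEAR `1`**:
`Ū^{pr}(V)(c)·Ū₀(c)⋆ = h(V)(c₋)·(Ū_h(V)(c)·Ū₀(c)⋆)·(Ū₀(c)·h⁻¹(V)(c₊)·Ū₀(c)⋆)` (insert `Ū₀⋆Ū₀ = 1`), hence `‖Ū^{pr}(V)(c)Ū₀(c)⋆ − 1‖ ≤ (1+θ)(1+δ)(1+θ) − 1`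
from `‖h − 1‖, ‖h⁻¹ − 1‖ ≤ θ`, `‖Ū_hŪ₀⋆ − 1‖ ≤ δ` (unitary conjugation is an isometry). [cite: Balaban1985Averaging, (92) p.31, p.24] -/
theorem norm_avPrM_mul_star_sub_one_le (𝔥 : FrameDatum P N k U₀) (V : PBond P 0 → Matrix (Fin N) (Fin N) ℂ) (c : PBond P k) {θ δ : ℝ}
    (hmap : ‖𝔥.map V c.src - 1‖ ≤ θ) (hinv : ‖𝔥.inv V c.tgt - 1‖ ≤ θ)
    (hit : ‖iterMh k V c * star ((Averaging.iter (fun j => blockAvg (P := P) (j := j) expMeanLogSU) k U₀ c : SU N) : Matrix (Fin N) (Fin N) ℂ) - 1‖ ≤ δ) :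
    ‖avPrM 𝔥 V c * star ((Averaging.iter (fun j => blockAvg (P := P) (j := j) expMeanLogSU) k U₀ c : SU N) : Matrix (Fin N) (Fin N) ℂ) - 1‖
      ≤ (1 + θ) * (1 + δ) * (1 + θ) - 1 := by
  set W : Matrix (Fin N) (Fin N) ℂ := ((Averaging.iter (fun j => blockAvg (P := P) (j := j) expMeanLogSU) k U₀ c : SU N) : Matrix (Fin N) (Fin N) ℂ) with hW
  have hWu : W ∈ Matrix.unitaryGroup (Fin N) ℂ := Matrix.specialUnitaryGroup_le_unitaryGroup (Averaging.iter _ k U₀ c).2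
  have hsu : star W * W = 1 := Unitary.star_mul_self_of_mem hWu
  have key : avPrM 𝔥 V c * star W = 𝔥.map V c.src * (iterMh k V c * star W) * (W * 𝔥.inv V c.tgt * star W) := by
    rw [avPrM_apply]
    simp only [mul_assoc]
    rw [← mul_assoc (star W) W, hsu, one_mul]
  rw [key]
  have hC : ‖W * 𝔥.inv V c.tgt * star W - 1‖ ≤ θ := by rw [norm_unitary_conj_sub_one_eq hWu]; exact hinv
  exact norm_mul3_sub_one_le hmap hit hC

/-- **THE FRAMED CHART IS ANALYTIC AT EVERY POINT OF THE FRAME WINDOW CARRYING THE TWO LETTERS** (`e^{iX}U₀ ∈ dom h`, polydisc below `k`, framed log-disc at `k`): composition of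
`exp`, the frame datum's analytic `h`∕`h⁻¹` with the holomorphic averaging (def-Y ✓`analyticAt_avPrM_apply`), and `log` (✓`analyticAt_logOver_apply`) — the framed edition of F5
✓`analyticAt_logChart_iterMh`. [cite: Balaban1985Variational, Sect. G p.307, Prop. 9 p.309; Balaban1985Averaging, (92) p.31; Balaban1987RG1, (0.4) p.253] -/
theorem analyticAt_framedLogChart (𝔥 : FrameDatum P N k U₀) {X : PBond P 0 → Matrix (Fin N) (Fin N) ℂ} (hdom : expOver U₀ X ∈ 𝔥.dom)
    (hpoly : ∀ j, j < k → ∀ (c : PBond P (j + 1)) (i : Idx P), ‖loopMh (iterMh j (expOver U₀ X)) c i - 1‖ < 1)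
    (hlog : ∀ c : PBond P k,
      ‖avPrM 𝔥 (expOver U₀ X) c * star ((Averaging.iter (fun j => blockAvg (P := P) (j := j) expMeanLogSU) k U₀ c : SU N) : Matrix (Fin N) (Fin N) ℂ) - 1‖ < 1) :
    AnalyticAt ℂ (fun Y : PBond P 0 → Matrix (Fin N) (Fin N) ℂ =>
      logOver (coeField (Averaging.iter (fun j => blockAvg (P := P) (j := j) expMeanLogSU) k U₀)) (avPrM 𝔥 (expOver U₀ Y))) X := by
  have hav : AnalyticAt ℂ (fun Z : PBond P 0 → Matrix (Fin N) (Fin N) ℂ => fun c : PBond P k => avPrM 𝔥 (expOver U₀ Z) c) X :=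
    analyticAt_pi_iff.2 fun c => (analyticAt_avPrM_apply 𝔥 hdom hpoly c).comp (analyticAt_expOver U₀ X)
  refine analyticAt_pi_iff.2 fun c => ?_
  exact (analyticAt_logOver_apply (coeField (Averaging.iter (fun j => blockAvg (P := P) (j := j) expMeanLogSU) k U₀)) c (hlog c)).comp_of_eq hav rfl

end Framed

end Summit.QuantumFields.YangMills.Theorems.C44IterMh

end
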